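import Summits.BirchSwinnertonDyer.BirchSwinnertonDyer.Theorems.QuadraticBranchSignedControlPlusEtaNonsurjConjADoorUnit
import Summits.BirchSwinnertonDyer.Rank1Residual.X11b.ChaPairsMinimality
import HarnessLib

/-!
# Route `QuadraticBranchSignedControl` (rung K8, cell `bsd-potss`), residual crux `PlusEtaMainConjectureNonsurj`
# (stmt-BirchSwinnertonDyer-19606): UNCONGRUENT RECORDS D — (C1⁺_η) at `p = 5` BY NAME on members of the uncongruent family u5a newly resolved by the
# long run (kit j330280, engine e5.gp 2e115a13 byte-identical, `bnfinit` cap 20000 s; seat `bsd-potss-k8eta-c2` g22)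

WHAT. The family u5a = the `5`-partners `W_D` of the twists `A^{(D)}` of `A = [1,−1,1,−4010,98676]` (Zywina's `X_ns⁺(5)` point `t = 4/5`; non-CM,
image `C_ns⁺(5)`, in NO `5`-congruence class of a CM row — the domain of v7's hardest stub). g21's kit j326613 resolved 22 of 104 members at a
6000 s `bnfinit` cap; this seat's j330280 re-ran the 52 unresolved members of record shape (34 prime-`L` rank one, 18 unit) at 20000 s. Rows of
this file: u5a:76 (unit, L6⁻; h = 960) — each with a kernel door PASS (L6⁻: `v₅ h(ℚ(P)) ≤ v₅ h(ℚ(x(P))) = 1`, or L2: `2` not an eigenvalue of `σ₂`) and a record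
shape: UNIT (`ε = +1`, `λ⁺ = μ⁺ = 0`, `r_an = 0`; the unit-row door p715862) or prime-`L` rank one (`ε = −1`, `λ⁺ = 1`, `μ⁺ = 0`, `r_an = 1`; g21's
record shapes p703871 / p708181). Kernel: `Δ ≠ 0` per curve.

HONEST FRAMING (cell `bsd-potss`; FULL-BSD rank ≤ 1 programme, HUMAN RULING D-0036/D-0074): per-row RECORDS, CONDITIONAL on the displayed named facts
and per-row inputs (GRH class numbers, PARI certificates, the twin `V` with its tower clause); no stub of 19606 proved; crux and route OPEN; nothing
booked; `BSD(W,5)` claimed for no pair. `--supports stmt-BirchSwinnertonDyer-19606`.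

References: [Kobayashi2003] Thm. 2.2, §4, Thm. 4.1; [CoatesSujatha2005] §3 (A), Thm. 3.4; [NeukirchANT1999] III §1 (1.6); [Zywina2015] Thm. 1.4.
-/

set_option autoImplicit false
set_option linter.dupNamespace false
noncomputable section

open scoped Classical nonZeroDivisors

open CongruenceSubgroup NumberField Field WeierstrassCurve
open Literature.NumberTheory.EllipticCurves Literature.NumberTheory.EllipticCurves.ModularForms
  Literature.NumberTheory.EllipticCurves.Rank1Residual Literature.NumberTheory.EllipticCurves.Rank1Residual.Typed
  Literature.NumberTheory.GaloisRepresentations Literature.NumberTheory.GaloisCohomology Literature.NumberTheory.NumberFields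
  Literature.NumberTheory.EllipticCurves.GreenbergVatsal2000 ZpExtension
open Summit.BirchSwinnertonDyer.Rank1Residual Summit.BirchSwinnertonDyer.Rank1Residual.Additive
open Summit.BirchSwinnertonDyer.Rank1Residual.X11b (isElliptic_of_discOf_ne_zero)
open Summit.BirchSwinnertonDyer.BirchSwinnertonDyer.Theorems
open Summit.BirchSwinnertonDyer.Rank1Residual.X11b (isElliptic_of_discOf_ne_zero)
open Summit.BirchSwinnertonDyer.BirchSwinnertonDyer.Theorems.EtaConjADoorUnit
  (quadraticBranchPlusEtaMainConjectureAt_of_relClassNumber_of_isUnit quadraticBranchPlusEtaMainConjectureAt_of_eigenHom_of_isUnit)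

namespace Summit.BirchSwinnertonDyer.BirchSwinnertonDyer.Theorems.EtaConjADoorUnitRecords

/-- The `5`-partner of u5a:76, `W = [0, 0, 0, -578998875, 5359559154250]` (non-CM, `N_W = 6304359600`; `j(W) = j(A)` for the quadratic twist
`A^{(76)}` of `A = [1,−1,1,−4010,98676]` (the `t = 4/5` point of Zywina's `X_ns⁺(5)` family; non-CM, mod-`5` image `C_ns⁺(5)`, NOT `5`-congruent to
any CM row — k8eta-c2 g19 p666083: the domain of v7's hardest stub `stub_etaMC_nonCM_uncongruent`)): `Δ ≠ 0` (kernel). [cite: Zywina2015, Thm. 1.4]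
-/
theorem isElliptic_u5a_76 : (⟨0, 0, 0, (-578998875), 5359559154250⟩ : WeierstrassCurve ℚ).IsElliptic :=
  isElliptic_of_discOf_ne_zero 0 0 0 (-578998875) 5359559154250 (by decide +kernel)

/-- **(C1⁺_η) at `p = 5` for every good `a_5 = 0` model `V` of the `5`-twist of the UNCONGRUENT UNIT partner u5a:76** (`W = [0, 0, 0, -578998875,
5359559154250]`, non-CM, `N_W = 6304359600`; kit j330280 (4763 s, GRH): `ε(W) = +1`, PARI plus-`η` `(λ, μ) = (0, 0)` — `L_5⁺(V,η,T)` is a UNIT of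
`Λ` —, `r_an(W) = 0` (`unit certificate (lambda+,mu+)=(0,0) => L(W,1)!=0 by (3.6); ellanalyticrank infeasible at N_W=6.3e9 (j334001/j334005
stack)`); `h(ℚ(P)) = 960` (`[60,2,2,2,2]`), `h(ℚ(x(P))) = 15`; eigen dimensions `(d₁,d₂,d₃,d₄) = (0,0,0,1)` — door L6⁻ (relative class number)
passes) from the ROW ALONE — named facts `h22 h41 h6273` ONLY (no `hGZK`, no `r_an`, no `L₀`); displayed: the tower clause, the unit certificate
«every `L_5⁺(V,η,T)` is a unit», the class-group datum. Instance of
`EtaConjADoorUnit.quadraticBranchPlusEtaMainConjectureAt_of_relClassNumber_of_isUnit` (k8eta-c2 g22, p715862). CONDITIONAL; nothing booked. [cite: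
Kobayashi2003, §4 (p. 8), Thm. 2.2 (p. 5)] [cite: CoatesSujatha2005, §3 (A) and Thm. 3.4] [cite: Zywina2015, Thm. 1.4] -/
theorem etaMC_unit_u5a_76_5_of_relClassNumber
    (h22 : Kobayashi2003.thm22_etaSignedSelmerDual_finite_torsion)
    (h41 : Kobayashi2003.thm41_plusEtaCharIdeal_dvd)
    (h6273 : Kobayashi2003.thm62_63_73_etaColemanPoitouTate) [Fact (5 : ℕ).Prime]
    (W : WeierstrassCurve ℚ) (hW : W = (⟨0, 0, 0, (-578998875), 5359559154250⟩ : WeierstrassCurve ℚ))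
    (V : WeierstrassCurve ℚ) [V.IsElliptic] [V.IsGloballyMinimal] (C : VariableChange ℚ)
    (hC : C • W.quadraticTwist 5 = V)
    (hgood : V.HasGoodReductionAtPrime 5) (hap : V.frobeniusTrace 5 = 0)
    (hns : ¬ ∀ m : ℕ, V.HasSurjectiveModNGaloisRep (5 ^ m : ℕ))
    (hunit : ∀ {N : ℕ} [NeZero N] {f : CuspForm (Gamma0 N) 2}, IsNewformOf V f →
      ∀ (ϖ : ℚ), (if Even (5 / 2) then (ϖ : ℝ) * V.realPeriodRat = plusPeriod f
          else (ϖ : ℝ) * V.imaginaryPeriodRat = minusPeriod f) →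
      ∀ (Lη : IwasawaAlgebra 5), IsQuadraticBranchPlusLFunction f 5 ϖ Lη → IsUnit Lη)
    (hP : haveI : W.IsElliptic := hW ▸ isElliptic_u5a_76
      haveI : NeZero (5 : ℕ) := ⟨by norm_num⟩
      haveI : NumberField (W.divisionField 5) := NumberField.mk
      ∃ P : geomTorsion W ((5 : ℕ) : ℤ), P ≠ 0 ∧ ∀ τ : absoluteGaloisGroup ℚ, τ • P = -P →
        ∀ K : IntermediateField ℚ (W.divisionField 5),
          K = IntermediateField.fixedField
            ((MulAction.stabilizer (absoluteGaloisGroup ℚ) P).map (absRestrictNormalHom (W.divisionField 5))) →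
        ∀ σ : K ≃ₐ[ℚ] K,
          (∀ x : K, absRestrictNormalHom (W.divisionField 5) τ (x : W.divisionField 5) =
            ((σ x : K) : W.divisionField 5)) →
          padicValNat 5 (NumberField.classNumber K) ≤
            padicValNat 5 (NumberField.classNumber (IntermediateField.fixedField (Subgroup.zpowers σ)))) :
    QuadraticBranchPlusEtaMainConjectureAt V 5 := by
  subst hW
  haveI : (⟨0, 0, 0, (-578998875), 5359559154250⟩ : WeierstrassCurve ℚ).IsElliptic := isElliptic_u5a_76
  haveI : NeZero (5 : ℕ) := ⟨by norm_num⟩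
  exact quadraticBranchPlusEtaMainConjectureAt_of_relClassNumber_of_isUnit 5 V _ C h22 h41 h6273 (le_refl 5)
    (by rw [show ((-1 : ℚ) ^ ((5 : ℕ) / 2) * ((5 : ℕ) : ℚ)) = 5 by norm_num]; exact hC) hgood hap hns hP hunit

end Summit.BirchSwinnertonDyer.BirchSwinnertonDyer.Theorems.EtaConjADoorUnitRecords

end
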